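import Summits.Schanuel.Schanuel.Theorems.RootDecomp1QuadricAbsorption

/-!
# RootDecomp1QuadricAbsorption — continuation (RootDecomp1QuadricAbsorptionPlanes): §3 POWER PLANES `y₀·(1, ρ, ρ²)` and
PRODUCT PLANES `(u, v, uv)` decided for item D with NO hypothesis

Second part of the three-file split (400-line rule) of lens 1's gen-18 node «QuadricAbsorption» (ROUND 18 of
route-Schanuel-RootDecomp1, THEOREM ROUND + CORRECTION; `--supports stmt-Schanuel-30353`); shared namespace
`Summit.Schanuel.Schanuel.Theorems.RootDecomp1QuadricAbsorption`; the first part carries the node docstring.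
Sorry-free; standard axioms.  Nothing here proves Schanuel; rung 0.
-/

noncomputable section

namespace Summit.Schanuel.Schanuel.Theorems.RootDecomp1QuadricAbsorption

open Complex IntermediateField Module Polynomial
open Literature.NumberTheory.Transcendental (algebraicIndependent_exp_holds nesterenko)
open Summit.Schanuel.Schanuel.Theorems.RootDecomp1EAnchor (isAlgebraic_of_mem_adjoin)
open Summit.Schanuel.Schanuel.Theorems.RootDecomp1EEStableRung (one_le_trdeg_adjoin_of_transcendental)
open Summit.Schanuel.Schanuel.Theorems.RootDecomp1ArgumentCells (le_trdeg_of_algebraicIndependent_mem)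
open Summit.Schanuel.Schanuel.Theorems.RootDecomp1AdditiveCells (le_trdeg_of_additive_cert)
open Summit.Schanuel.Schanuel.Theorems.RootDecomp1AdditiveCellsD (pair_one_linearIndependent)
open Summit.Schanuel.Schanuel.Theorems.RootDecomp1ResidueSieve (powerPlane powerPlane_zero powerPlane_one
  powerPlane_two powerPlane_linearIndependent two_le_argDegree_powerPlane not_isAlgebraic_of_algebraicIndependent_pair
  expPiPowerPlane algebraicIndependent_expPi_pi)

/-! ## §0  Toolkit -/

/-- A transcendental number is non-zero. -/
private theorem ne_zero_of_transcendental {w : ℂ} (hw : Transcendental ℚ w) : w ≠ 0 := by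
  rintro rfl
  exact hw isAlgebraic_zero

/-! ## §3  POWER PLANES `y₀·(1, ρ, ρ²)` AND PRODUCT PLANES `(u, v, uv)` — decided for item D with NO hypothesis
(supersedes round 16's `…_powerPlane_of_fourExp` and round 17's σ-cells as far as D is concerned). -/

/-- The `0/1` table of the quadratic parametrisation of a power plane by `t = (s, sρ)`, `s² = y₀`:
`y₀ = t₀t₀`, `y₀ρ = t₀t₁`, `y₀ρ² = t₁t₁`. -/
def powerPlaneQuadCoeff : Fin 3 → Fin 2 → Fin 2 → ℂ :=
  ![![![1, 0], ![0, 0]], ![![0, 1], ![0, 0]], ![![0, 0], ![0, 1]]]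

/-- The table entries are `0` or `1`, hence algebraic. -/
theorem powerPlaneQuadCoeff_isAlgebraic (m : Fin 3) (j j' : Fin 2) : IsAlgebraic ℚ (powerPlaneQuadCoeff m j j') := by
  fin_cases m <;> fin_cases j <;> fin_cases j' <;> simp [powerPlaneQuadCoeff, isAlgebraic_zero, isAlgebraic_one]

/-- **A power plane with base `s²` is the quadratic image of `t = (s, sρ)`.** -/
theorem powerPlane_sq_eq_quadratic (s ρ : ℂ) (m : Fin 3) :
    powerPlane (s ^ 2) ρ m = ∑ j, ∑ j', powerPlaneQuadCoeff m j j' * (![s, s * ρ] j * ![s, s * ρ] j') := by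
  fin_cases m <;> simp [powerPlane, powerPlaneQuadCoeff, Fin.sum_univ_two] <;> ring

/-- Every power plane is an algebraic-coefficient quadratic image of TWO parameters (the S/Q reading: a log-type
triple on a power plane is a point of the quadratic-image item's scope with `k = 2 < 3`). -/
theorem powerPlane_isQuadraticImage (y₀ ρ : ℂ) :
    ∃ (t : Fin 2 → ℂ) (δ : Fin 3 → Fin 2 → Fin 2 → ℂ), (∀ m j j', IsAlgebraic ℚ (δ m j j')) ∧
      ∀ m, powerPlane y₀ ρ m = ∑ j, ∑ j', δ m j j' * (t j * t j') := by
  obtain ⟨s, hs⟩ := IsAlgClosed.exists_pow_nat_eq y₀ (by norm_num : 0 < 2)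
  exact ⟨![s, s * ρ], powerPlaneQuadCoeff, powerPlaneQuadCoeff_isAlgebraic, fun m => by
    rw [← hs]; exact powerPlane_sq_eq_quadratic s ρ m⟩

/-- **POWER-PLANE COVER (pointwise): a triple `z` drawn from a power plane, with `trdeg ℚ(z) ≥ 2`, satisfies D given
its own binders h5 and `ε = 0` — NO Four Exponentials, NO σ-condition, NO Nesterenko.** -/
theorem disjointSchanuel_three_of_powerPlane_cover {y₀ ρ : ℂ} {z : Fin 3 → ℂ} (m : Fin 3 → Fin 3)
    (hm : ∀ i, powerPlane y₀ ρ (m i) = z i) (ha : (2 : Cardinal) ≤ Algebra.trdeg ℚ ↥(adjoin ℚ (Set.range z)))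
    (h5 : ∀ (k : ℕ) (t : Fin k → ℂ) (β₀ γ₀ : Fin 3 → ℂ) (β γ : Fin 3 → Fin k → ℂ) (δ ε : Fin 3 → Fin k → Fin k → ℂ),
      (∀ i, IsAlgebraic ℚ (β₀ i)) → (∀ i j, IsAlgebraic ℚ (β i j)) → (∀ i j j', IsAlgebraic ℚ (δ i j j')) →
      (∀ i, IsAlgebraic ℚ (γ₀ i)) → (∀ i j, IsAlgebraic ℚ (γ i j)) → (∀ i j j', IsAlgebraic ℚ (ε i j j')) →
      (∀ i, z i = β₀ i + ∑ j, β i j * t j + ∑ j, ∑ j', δ i j j' * (t j * t j')) →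
      (∀ i, Complex.exp (z i) = γ₀ i + ∑ j, γ i j * t j + ∑ j, ∑ j', ε i j j' * (t j * t j')) → 3 ≤ k)
    (hsplit : Algebra.trdeg ℚ ↥(adjoin ℚ (Set.range z)) + Algebra.trdeg ℚ ↥(adjoin ℚ (Set.range (cexp ∘ z))) ≤
      Algebra.trdeg ℚ ↥(adjoin ℚ (Set.range z ∪ Set.range (cexp ∘ z)))) :
    ((3 : ℕ) : Cardinal) ≤ Algebra.trdeg ℚ ↥(adjoin ℚ (Set.range z ∪ Set.range (cexp ∘ z))) := by
  obtain ⟨s, hs⟩ := IsAlgClosed.exists_pow_nat_eq y₀ (by norm_num : 0 < 2)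
  refine disjointSchanuel_of_quadraticImage z h5 (a := 2) (by norm_num) (by exact_mod_cast ha) (k := 2)
    (by norm_num) ![s, s * ρ] (fun _ => 0) (fun _ _ => 0) (fun i => powerPlaneQuadCoeff (m i))
    (fun _ => isAlgebraic_zero) (fun _ _ => isAlgebraic_zero)
    (fun i j j' => powerPlaneQuadCoeff_isAlgebraic (m i) j j') (fun i => ?_) hsplit
  simp only [zero_mul, Finset.sum_const_zero, zero_add]
  rw [← hm i, ← hs]
  exact powerPlane_sq_eq_quadratic s ρ (m i)

/-- **POWER PLANES (pointwise): `(y₀, ρ)` algebraically independent ⟹ D at `y₀·(1, ρ, ρ²)`, for EVERY such `ρ`.** -/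
theorem disjointSchanuel_powerPlane {y₀ ρ : ℂ} (hai : AlgebraicIndependent ℚ ![y₀, ρ])
    (h5 : ∀ (k : ℕ) (t : Fin k → ℂ) (β₀ γ₀ : Fin 3 → ℂ) (β γ : Fin 3 → Fin k → ℂ) (δ ε : Fin 3 → Fin k → Fin k → ℂ),
      (∀ i, IsAlgebraic ℚ (β₀ i)) → (∀ i j, IsAlgebraic ℚ (β i j)) → (∀ i j j', IsAlgebraic ℚ (δ i j j')) →
      (∀ i, IsAlgebraic ℚ (γ₀ i)) → (∀ i j, IsAlgebraic ℚ (γ i j)) → (∀ i j j', IsAlgebraic ℚ (ε i j j')) →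
      (∀ i, powerPlane y₀ ρ i = β₀ i + ∑ j, β i j * t j + ∑ j, ∑ j', δ i j j' * (t j * t j')) →
      (∀ i, Complex.exp (powerPlane y₀ ρ i) = γ₀ i + ∑ j, γ i j * t j + ∑ j, ∑ j', ε i j j' * (t j * t j')) →
      3 ≤ k)
    (hsplit : Algebra.trdeg ℚ ↥(adjoin ℚ (Set.range (powerPlane y₀ ρ))) +
        Algebra.trdeg ℚ ↥(adjoin ℚ (Set.range (cexp ∘ powerPlane y₀ ρ))) ≤
      Algebra.trdeg ℚ ↥(adjoin ℚ (Set.range (powerPlane y₀ ρ) ∪ Set.range (cexp ∘ powerPlane y₀ ρ)))) :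
    ((3 : ℕ) : Cardinal) ≤
      Algebra.trdeg ℚ ↥(adjoin ℚ (Set.range (powerPlane y₀ ρ) ∪ Set.range (cexp ∘ powerPlane y₀ ρ))) :=
  disjointSchanuel_three_of_powerPlane_cover id (fun _ => rfl) (two_le_argDegree_powerPlane hai) h5 hsplit

/-- **THE POWER-PLANE CELL (item form, binders of stmt-Schanuel-30353 verbatim) — round 16's
`disjointSaturatedEssentialSchanuel_powerPlane_of_fourExp` with the hypothesis `FourExponentialsConjecture`
DELETED.**  Cell: `{n = 3, Set.range z = Set.range (y₀·(1, ρ, ρ²)), (y₀, ρ) algebraically independent}`. -/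
theorem disjointSaturatedEssentialSchanuel_powerPlane :
    ∀ (n : ℕ), 3 ≤ n → ∀ (z : Fin n → ℂ), LinearIndependent ℚ z →
      (n ≤ 3 ∧ ∃ y₀ ρ : ℂ, AlgebraicIndependent ℚ ![y₀, ρ] ∧ Set.range z = Set.range (powerPlane y₀ ρ)) →
      (∀ i, z i ∈ Literature.NumberTheory.Transcendental.ecl (∅ : Set ℂ)) →
      (∀ (m : ℕ), m < n → ∀ (w : Fin m → ℂ), LinearIndependent ℚ w →
        (∀ i, w i ∈ Submodule.span ℚ (Set.range z)) →
        (m : Cardinal) ≤ Algebra.trdeg ℚ ↥(IntermediateField.adjoin ℚ (Set.range w ∪ Set.range (Complex.exp ∘ w)))) →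
      (∀ w : ℂ, IsAlgebraic ↥(IntermediateField.adjoin ℚ (Set.range z ∪ Set.range (Complex.exp ∘ z))) w →
        IsAlgebraic ↥(IntermediateField.adjoin ℚ (Set.range z ∪ Set.range (Complex.exp ∘ z))) (Complex.exp w) →
        w ∈ Submodule.span ℚ (Set.range z)) →
      (∀ (k : ℕ) (t : Fin k → ℂ) (β₀ γ₀ : Fin n → ℂ) (β γ : Fin n → Fin k → ℂ), (∀ i, IsAlgebraic ℚ (β₀ i)) →
        (∀ i j, IsAlgebraic ℚ (β i j)) → (∀ i, IsAlgebraic ℚ (γ₀ i)) → (∀ i j, IsAlgebraic ℚ (γ i j)) →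
        (∀ i, z i = β₀ i + ∑ j, β i j * t j) → (∀ i, Complex.exp (z i) = γ₀ i + ∑ j, γ i j * t j) → n ≤ k) →
      (∀ (k : ℕ) (t : Fin k → ℂ) (β₀ γ₀ : Fin n → ℂ) (β γ : Fin n → Fin k → ℂ) (δ ε : Fin n → Fin k → Fin k → ℂ),
        (∀ i, IsAlgebraic ℚ (β₀ i)) → (∀ i j, IsAlgebraic ℚ (β i j)) → (∀ i j j', IsAlgebraic ℚ (δ i j j')) →
        (∀ i, IsAlgebraic ℚ (γ₀ i)) → (∀ i j, IsAlgebraic ℚ (γ i j)) → (∀ i j j', IsAlgebraic ℚ (ε i j j')) →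
        (∀ i, z i = β₀ i + ∑ j, β i j * t j + ∑ j, ∑ j', δ i j j' * (t j * t j')) →
        (∀ i, Complex.exp (z i) = γ₀ i + ∑ j, γ i j * t j + ∑ j, ∑ j', ε i j j' * (t j * t j')) → n ≤ k) →
      (∀ (k : ℕ) (t : Fin k → ℂ) (D : MvPolynomial (Fin k) ℂ) (N E : Fin n → MvPolynomial (Fin k) ℂ),
        (∀ m, IsAlgebraic ℚ (MvPolynomial.coeff m D)) → (∀ i m, IsAlgebraic ℚ (MvPolynomial.coeff m (N i))) →
        (∀ i m, IsAlgebraic ℚ (MvPolynomial.coeff m (E i))) → MvPolynomial.eval t D ≠ 0 →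
        (∀ i, z i * MvPolynomial.eval t D = MvPolynomial.eval t (N i)) →
        (∀ i, Complex.exp (z i) * MvPolynomial.eval t D = MvPolynomial.eval t (E i)) → n ≤ k) →
      (Algebra.trdeg ℚ ↥(IntermediateField.adjoin ℚ (Set.range z)) +
          Algebra.trdeg ℚ ↥(IntermediateField.adjoin ℚ (Set.range (Complex.exp ∘ z))) ≤
        Algebra.trdeg ℚ ↥(IntermediateField.adjoin ℚ (Set.range z ∪ Set.range (Complex.exp ∘ z)))) →
      (n : Cardinal) ≤ Algebra.trdeg ℚ ↥(IntermediateField.adjoin ℚ (Set.range z ∪ Set.range (Complex.exp ∘ z))) := by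
  intro n hn z hz hcell _ _ _ _ h5 _ hsplit
  obtain rfl : n = 3 := le_antisymm hcell.1 hn
  obtain ⟨y₀, ρ, hai, hzr⟩ := hcell.2
  have hcov : ∀ i, ∃ m : Fin 3, powerPlane y₀ ρ m = z i := fun i => by
    rw [← Set.mem_range, ← hzr]
    exact Set.mem_range_self i
  choose m hm using hcov
  have ha : (2 : Cardinal) ≤ Algebra.trdeg ℚ ↥(adjoin ℚ (Set.range z)) := by
    rw [hzr]
    exact two_le_argDegree_powerPlane hai
  exact disjointSchanuel_three_of_powerPlane_cover m hm ha h5 hsplit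

/-! ### Product planes `(u, v, uv)` -/

/-- The product plane `(u, v, uv)`. -/
def productPlane (u v : ℂ) : Fin 3 → ℂ := ![u, v, u * v]

/-- `productPlane u v 0 = u`. -/
@[simp] theorem productPlane_zero (u v : ℂ) : productPlane u v 0 = u := rfl
/-- `productPlane u v 1 = v`. -/
@[simp] theorem productPlane_one (u v : ℂ) : productPlane u v 1 = v := rfl
/-- `productPlane u v 2 = u * v`. -/
@[simp] theorem productPlane_two (u v : ℂ) : productPlane u v 2 = u * v := rfl

/-- Linear part of the quadratic parametrisation of `(u, v, uv)` by `t = (u, v)`. -/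
def productPlaneLinCoeff : Fin 3 → Fin 2 → ℂ := ![![1, 0], ![0, 1], ![0, 0]]

/-- Quadratic part of the quadratic parametrisation of `(u, v, uv)` by `t = (u, v)`. -/
def productPlaneQuadCoeff : Fin 3 → Fin 2 → Fin 2 → ℂ :=
  ![![![0, 0], ![0, 0]], ![![0, 0], ![0, 0]], ![![0, 1], ![0, 0]]]

/-- The linear table is `0/1`-valued, hence algebraic. -/
theorem productPlaneLinCoeff_isAlgebraic (m : Fin 3) (j : Fin 2) : IsAlgebraic ℚ (productPlaneLinCoeff m j) := by
  fin_cases m <;> fin_cases j <;> simp [productPlaneLinCoeff, isAlgebraic_zero, isAlgebraic_one]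

/-- The quadratic table is `0/1`-valued, hence algebraic. -/
theorem productPlaneQuadCoeff_isAlgebraic (m : Fin 3) (j j' : Fin 2) :
    IsAlgebraic ℚ (productPlaneQuadCoeff m j j') := by
  fin_cases m <;> fin_cases j <;> fin_cases j' <;> simp [productPlaneQuadCoeff, isAlgebraic_zero, isAlgebraic_one]

/-- **`(u, v, uv)` is the quadratic image of `t = (u, v)`.** -/
theorem productPlane_eq_quadratic (u v : ℂ) (m : Fin 3) :
    productPlane u v m = ∑ j, productPlaneLinCoeff m j * ![u, v] j +
      ∑ j, ∑ j', productPlaneQuadCoeff m j j' * (![u, v] j * ![u, v] j') := by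
  fin_cases m <;> simp [productPlane, productPlaneLinCoeff, productPlaneQuadCoeff, Fin.sum_univ_two]

/-- `(u, v)` algebraically independent ⟹ `trdeg ℚ(u, v, uv) ≥ 2`. -/
theorem two_le_argDegree_productPlane {u v : ℂ} (hai : AlgebraicIndependent ℚ ![u, v]) :
    (2 : Cardinal) ≤ Algebra.trdeg ℚ ↥(adjoin ℚ (Set.range (productPlane u v))) := by
  have h0 : u ∈ adjoin ℚ (Set.range (productPlane u v)) := subset_adjoin ℚ _ ⟨0, rfl⟩
  have h1 : v ∈ adjoin ℚ (Set.range (productPlane u v)) := subset_adjoin ℚ _ ⟨1, rfl⟩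
  have h := le_trdeg_of_algebraicIndependent_mem (adjoin ℚ (Set.range (productPlane u v))) hai
    (fun i => by fin_cases i <;> simp [h0, h1])
  exact_mod_cast h

/-- `(u, v)` algebraically independent ⟹ `(u, v, uv)` is ℚ-free (a genuine instance of the format `n = 3`). -/
theorem productPlane_linearIndependent {u v : ℂ} (hai : AlgebraicIndependent ℚ ![u, v]) :
    LinearIndependent ℚ (productPlane u v) := by
  have hu : Transcendental ℚ u := by simpa using hai.transcendental 0
  rw [Fintype.linearIndependent_iff]
  intro g hg
  have hsum : (g 0 : ℂ) * u + (g 1 : ℂ) * v + (g 2 : ℂ) * (u * v) = 0 := by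
    simpa [productPlane, Fin.sum_univ_three, Rat.smul_def] using hg
  set K := adjoin ℚ ({u} : Set ℂ) with hK
  have huK : u ∈ K := mem_adjoin_simple_self ℚ _
  have hq : ∀ q : ℚ, (q : ℂ) ∈ K := fun q => by simp
  by_cases hc : (g 1 : ℂ) + (g 2 : ℂ) * u = 0
  · have hli := pair_one_linearIndependent hu
    rw [LinearIndependent.pair_iff] at hli
    obtain ⟨h1, h2⟩ := hli (g 1) (g 2) (by simpa [Rat.smul_def] using hc)
    have h0 : g 0 = 0 := by
      have h : (g 0 : ℂ) * u = 0 := by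
        rw [h1, h2] at hsum
        simpa using hsum
      rcases mul_eq_zero.mp h with h | h
      · exact_mod_cast h
      · exact absurd h (ne_zero_of_transcendental hu)
    intro i
    fin_cases i
    · exact h0
    · exact h1
    · exact h2
  · exfalso
    have hv : v = -(g 0 : ℂ) * u / ((g 1 : ℂ) + (g 2 : ℂ) * u) := by
      rw [eq_div_iff hc]
      linear_combination hsum
    have hvK : v ∈ K := by
      rw [hv]
      exact div_mem (mul_mem (neg_mem (hq _)) huK) (add_mem (hq _) (mul_mem (hq _) huK))
    exact not_isAlgebraic_of_algebraicIndependent_pair hai (isAlgebraic_of_mem_adjoin hvK)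

/-- **PRODUCT-PLANE COVER (pointwise): a triple drawn from `(u, v, uv)` with `trdeg ℚ(z) ≥ 2` satisfies D given its
binders h5 and `ε = 0` — NO hypothesis.** -/
theorem disjointSchanuel_three_of_productPlane_cover {u v : ℂ} {z : Fin 3 → ℂ} (m : Fin 3 → Fin 3)
    (hm : ∀ i, productPlane u v (m i) = z i) (ha : (2 : Cardinal) ≤ Algebra.trdeg ℚ ↥(adjoin ℚ (Set.range z)))
    (h5 : ∀ (k : ℕ) (t : Fin k → ℂ) (β₀ γ₀ : Fin 3 → ℂ) (β γ : Fin 3 → Fin k → ℂ) (δ ε : Fin 3 → Fin k → Fin k → ℂ),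
      (∀ i, IsAlgebraic ℚ (β₀ i)) → (∀ i j, IsAlgebraic ℚ (β i j)) → (∀ i j j', IsAlgebraic ℚ (δ i j j')) →
      (∀ i, IsAlgebraic ℚ (γ₀ i)) → (∀ i j, IsAlgebraic ℚ (γ i j)) → (∀ i j j', IsAlgebraic ℚ (ε i j j')) →
      (∀ i, z i = β₀ i + ∑ j, β i j * t j + ∑ j, ∑ j', δ i j j' * (t j * t j')) →
      (∀ i, Complex.exp (z i) = γ₀ i + ∑ j, γ i j * t j + ∑ j, ∑ j', ε i j j' * (t j * t j')) → 3 ≤ k)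
    (hsplit : Algebra.trdeg ℚ ↥(adjoin ℚ (Set.range z)) + Algebra.trdeg ℚ ↥(adjoin ℚ (Set.range (cexp ∘ z))) ≤
      Algebra.trdeg ℚ ↥(adjoin ℚ (Set.range z ∪ Set.range (cexp ∘ z)))) :
    ((3 : ℕ) : Cardinal) ≤ Algebra.trdeg ℚ ↥(adjoin ℚ (Set.range z ∪ Set.range (cexp ∘ z))) := by
  refine disjointSchanuel_of_quadraticImage z h5 (a := 2) (by norm_num) (by exact_mod_cast ha) (k := 2)
    (by norm_num) ![u, v] (fun _ => 0) (fun i => productPlaneLinCoeff (m i)) (fun i => productPlaneQuadCoeff (m i))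
    (fun _ => isAlgebraic_zero) (fun i j => productPlaneLinCoeff_isAlgebraic (m i) j)
    (fun i j j' => productPlaneQuadCoeff_isAlgebraic (m i) j j') (fun i => ?_) hsplit
  rw [← hm i, zero_add]
  exact productPlane_eq_quadratic u v (m i)

/-- **PRODUCT PLANES (pointwise): `(u, v)` algebraically independent ⟹ D at `(u, v, uv)`.** -/
theorem disjointSchanuel_productPlane {u v : ℂ} (hai : AlgebraicIndependent ℚ ![u, v])
    (h5 : ∀ (k : ℕ) (t : Fin k → ℂ) (β₀ γ₀ : Fin 3 → ℂ) (β γ : Fin 3 → Fin k → ℂ) (δ ε : Fin 3 → Fin k → Fin k → ℂ),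
      (∀ i, IsAlgebraic ℚ (β₀ i)) → (∀ i j, IsAlgebraic ℚ (β i j)) → (∀ i j j', IsAlgebraic ℚ (δ i j j')) →
      (∀ i, IsAlgebraic ℚ (γ₀ i)) → (∀ i j, IsAlgebraic ℚ (γ i j)) → (∀ i j j', IsAlgebraic ℚ (ε i j j')) →
      (∀ i, productPlane u v i = β₀ i + ∑ j, β i j * t j + ∑ j, ∑ j', δ i j j' * (t j * t j')) →
      (∀ i, Complex.exp (productPlane u v i) = γ₀ i + ∑ j, γ i j * t j + ∑ j, ∑ j', ε i j j' * (t j * t j')) →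
      3 ≤ k)
    (hsplit : Algebra.trdeg ℚ ↥(adjoin ℚ (Set.range (productPlane u v))) +
        Algebra.trdeg ℚ ↥(adjoin ℚ (Set.range (cexp ∘ productPlane u v))) ≤
      Algebra.trdeg ℚ ↥(adjoin ℚ (Set.range (productPlane u v) ∪ Set.range (cexp ∘ productPlane u v)))) :
    ((3 : ℕ) : Cardinal) ≤
      Algebra.trdeg ℚ ↥(adjoin ℚ (Set.range (productPlane u v) ∪ Set.range (cexp ∘ productPlane u v))) :=
  disjointSchanuel_three_of_productPlane_cover id (fun _ => rfl) (two_le_argDegree_productPlane hai) h5 hsplit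

/-- **THE PRODUCT-PLANE CELL (item form, binders of stmt-Schanuel-30353 verbatim; NO hypothesis).**
Cell: `{n = 3, Set.range z = Set.range (u, v, uv), (u, v) algebraically independent}`. -/
theorem disjointSaturatedEssentialSchanuel_productPlane :
    ∀ (n : ℕ), 3 ≤ n → ∀ (z : Fin n → ℂ), LinearIndependent ℚ z →
      (n ≤ 3 ∧ ∃ u v : ℂ, AlgebraicIndependent ℚ ![u, v] ∧ Set.range z = Set.range (productPlane u v)) →
      (∀ i, z i ∈ Literature.NumberTheory.Transcendental.ecl (∅ : Set ℂ)) →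
      (∀ (m : ℕ), m < n → ∀ (w : Fin m → ℂ), LinearIndependent ℚ w →
        (∀ i, w i ∈ Submodule.span ℚ (Set.range z)) →
        (m : Cardinal) ≤ Algebra.trdeg ℚ ↥(IntermediateField.adjoin ℚ (Set.range w ∪ Set.range (Complex.exp ∘ w)))) →
      (∀ w : ℂ, IsAlgebraic ↥(IntermediateField.adjoin ℚ (Set.range z ∪ Set.range (Complex.exp ∘ z))) w →
        IsAlgebraic ↥(IntermediateField.adjoin ℚ (Set.range z ∪ Set.range (Complex.exp ∘ z))) (Complex.exp w) →
        w ∈ Submodule.span ℚ (Set.range z)) →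
      (∀ (k : ℕ) (t : Fin k → ℂ) (β₀ γ₀ : Fin n → ℂ) (β γ : Fin n → Fin k → ℂ), (∀ i, IsAlgebraic ℚ (β₀ i)) →
        (∀ i j, IsAlgebraic ℚ (β i j)) → (∀ i, IsAlgebraic ℚ (γ₀ i)) → (∀ i j, IsAlgebraic ℚ (γ i j)) →
        (∀ i, z i = β₀ i + ∑ j, β i j * t j) → (∀ i, Complex.exp (z i) = γ₀ i + ∑ j, γ i j * t j) → n ≤ k) →
      (∀ (k : ℕ) (t : Fin k → ℂ) (β₀ γ₀ : Fin n → ℂ) (β γ : Fin n → Fin k → ℂ) (δ ε : Fin n → Fin k → Fin k → ℂ),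
        (∀ i, IsAlgebraic ℚ (β₀ i)) → (∀ i j, IsAlgebraic ℚ (β i j)) → (∀ i j j', IsAlgebraic ℚ (δ i j j')) →
        (∀ i, IsAlgebraic ℚ (γ₀ i)) → (∀ i j, IsAlgebraic ℚ (γ i j)) → (∀ i j j', IsAlgebraic ℚ (ε i j j')) →
        (∀ i, z i = β₀ i + ∑ j, β i j * t j + ∑ j, ∑ j', δ i j j' * (t j * t j')) →
        (∀ i, Complex.exp (z i) = γ₀ i + ∑ j, γ i j * t j + ∑ j, ∑ j', ε i j j' * (t j * t j')) → n ≤ k) →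
      (∀ (k : ℕ) (t : Fin k → ℂ) (D : MvPolynomial (Fin k) ℂ) (N E : Fin n → MvPolynomial (Fin k) ℂ),
        (∀ m, IsAlgebraic ℚ (MvPolynomial.coeff m D)) → (∀ i m, IsAlgebraic ℚ (MvPolynomial.coeff m (N i))) →
        (∀ i m, IsAlgebraic ℚ (MvPolynomial.coeff m (E i))) → MvPolynomial.eval t D ≠ 0 →
        (∀ i, z i * MvPolynomial.eval t D = MvPolynomial.eval t (N i)) →
        (∀ i, Complex.exp (z i) * MvPolynomial.eval t D = MvPolynomial.eval t (E i)) → n ≤ k) →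
      (Algebra.trdeg ℚ ↥(IntermediateField.adjoin ℚ (Set.range z)) +
          Algebra.trdeg ℚ ↥(IntermediateField.adjoin ℚ (Set.range (Complex.exp ∘ z))) ≤
        Algebra.trdeg ℚ ↥(IntermediateField.adjoin ℚ (Set.range z ∪ Set.range (Complex.exp ∘ z)))) →
      (n : Cardinal) ≤ Algebra.trdeg ℚ ↥(IntermediateField.adjoin ℚ (Set.range z ∪ Set.range (Complex.exp ∘ z))) := by
  intro n hn z hz hcell _ _ _ _ h5 _ hsplit
  obtain rfl : n = 3 := le_antisymm hcell.1 hn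
  obtain ⟨u, v, hai, hzr⟩ := hcell.2
  have hcov : ∀ i, ∃ m : Fin 3, productPlane u v m = z i := fun i => by
    rw [← Set.mem_range, ← hzr]
    exact Set.mem_range_self i
  choose m hm using hcov
  have ha : (2 : Cardinal) ≤ Algebra.trdeg ℚ ↥(adjoin ℚ (Set.range z)) := by
    rw [hzr]
    exact two_le_argDegree_productPlane hai
  exact disjointSchanuel_three_of_productPlane_cover m hm ha h5 hsplit

end Summit.Schanuel.Schanuel.Theorems.RootDecomp1QuadricAbsorption
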